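import Summits.AtomisticToContinuum.Crystallization.Theorems.FrustratedLawDichotomyStrainedPatchHomLeafTableCheck

/-!
# Row semantics of the v2 `q`-table (soundness of `Row.ok`, generic and window mode) and of the table search

decomp-a2c hand-1 g20 (crux `AperiodicFrustratedLawGap`, stmt-AtomisticToContinuum-27623; critic row 806 (2)(C), first layer).  DEF-FREE.
`Row.ok_sound`: a certified row delivers, in real terms (`φ = W₄₅ ∘ √`, all data divided by `SC`), the value bound `±aV/SC ≤ φ(t/SC)`, the derivative
enclosure `φ′(t/SC) ∈ [(±aD − E)/SC, (±aD + E)/SC]`, and the curvature constant `M/SC` on `[A/SC, B/SC]` (`φ′ + (M/SC)·id` monotone) with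
`0 < A ≤ t ≤ B`.  Generic rows get this from the tree's `valLoOK_sound` / `derivOK_sound` / `curvOK_sound`; window rows (`t ≥ 9`, exact root `s`)
from the tree's window point bounds `phi45_window_ge`, `dphi45_window_ge/le`, `monotoneOn_dphi45_window` (glued with the far regime beyond `81/4`)
and the enclosure lemmas `mem_eWinVal` / `mem_eWinDer` / `mem_eWin`.  `QT.findLE_ok`: any row returned by the search from a certified table is
certified.  0 sorry; standard axioms.  `--supports stmt-AtomisticToContinuum-27623`.
-/

namespace Summit.AtomisticToContinuum.Crystallization.Theorems.FrustratedLawDichotomyStrainedPatchHomLeafTableCheck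

open Set
open Literature.Analysis.ValidatedNumerics.Numerics
open Summit.AtomisticToContinuum.Crystallization.Theorems.FrustratedLawDichotomySchurCut (effPot w₄₅ ω₄)
open Summit.AtomisticToContinuum.Crystallization.Theorems.FrustratedLawDichotomyStrainedPatchHomTermCalculus (monotoneOn_Icc_of_pieces)
open Summit.AtomisticToContinuum.Crystallization.Theorems.FrustratedLawDichotomyStrainedPatchHomTermCalculusSq (monotoneOn_dphi45_window
  monotoneOn_dphi45_far)
open Summit.AtomisticToContinuum.Crystallization.Theorems.FrustratedLawDichotomyStrainedPatchHomTermPointBounds (phi45_window_ge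
  dphi45_window_ge dphi45_window_le)
open Summit.AtomisticToContinuum.Crystallization.Theorems.FrustratedLawDichotomyStrainedPatchHomTermEval (curvOK curvOK_sound eWin mem_eWin)
open Summit.AtomisticToContinuum.Crystallization.Theorems.FrustratedLawDichotomyStrainedPatchHomTermEvalPoint
  (valLoOK_sound derivOK_sound eWinVal eWinDer mem_eWinVal mem_eWinDer)

/-- The literal `SCN` is the Literature scale `SC`. [formal bookkeeping] -/
theorem SCN_eq : SCN = SC := rfl

/-- Generic mode is sound. [folklore] -/
theorem Row.okGen_sound {E : ℕ} {r : Row} (h : r.okGen E = true) :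
    ((sgnZ r.sV r.aV : ℤ) : ℝ) / SC ≤ effPot w₄₅ ω₄ (3 / 400) (Real.sqrt (((r.t : ℤ) : ℝ) / SC)) ∧
    deriv (effPot w₄₅ ω₄ (3 / 400)) (Real.sqrt (((r.t : ℤ) : ℝ) / SC)) / (2 * Real.sqrt (((r.t : ℤ) : ℝ) / SC)) ∈
      Icc (((sgnZ r.sD r.aD - (E : ℤ) : ℤ) : ℝ) / SC) (((sgnZ r.sD r.aD + (E : ℤ) : ℤ) : ℝ) / SC) ∧
    0 ≤ ((r.M : ℤ) : ℝ) / SC ∧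
    MonotoneOn (fun t => deriv (effPot w₄₅ ω₄ (3 / 400)) (Real.sqrt t) / (2 * Real.sqrt t) + ((r.M : ℤ) : ℝ) / SC * t)
      (Icc (((r.A : ℤ) : ℝ) / SC) (((r.B : ℤ) : ℝ) / SC)) ∧
    0 < r.A ∧ r.A ≤ r.t ∧ r.t ≤ r.B := by
  unfold Row.okGen at h
  simp only [Bool.and_eq_true, Nat.ble_eq] at h
  obtain ⟨⟨⟨⟨hv, hd⟩, hc⟩, hA⟩, hB⟩ := h
  have hpos : 0 < (r.A : ℤ) := by
    have h' := hc
    unfold curvOK at h'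
    simp only [Bool.and_eq_true, decide_eq_true_eq] at h'
    exact h'.1.1.2
  exact ⟨valLoOK_sound hv, derivOK_sound hd, (curvOK_sound hc).1, (curvOK_sound hc).2, by exact_mod_cast hpos, hA, hB⟩

/-- Reading `n·x ≤ m·SCN` (naturals) as `x/SC ≤ m/n` (reals). [folklore] -/
theorem div_le_of_nat {x m n : ℕ} (hn : 0 < n) (h : n * x ≤ m * SCN) : ((x : ℤ) : ℝ) / SC ≤ (m : ℝ) / n := by
  have h' : (n : ℝ) * x ≤ m * SC := by rw [SCN_eq] at h; exact_mod_cast h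
  have hn' : (0:ℝ) < n := by exact_mod_cast hn
  rw [Int.cast_natCast, div_le_div_iff₀ SC_pos hn']
  nlinarith [h']

/-- Reading `m·SCN ≤ n·x` (naturals) as `m/n ≤ x/SC` (reals). [folklore] -/
theorem le_div_of_nat {x m n : ℕ} (hn : 0 < n) (h : m * SCN ≤ n * x) : (m : ℝ) / n ≤ ((x : ℤ) : ℝ) / SC := by
  have h' : (m : ℝ) * SC ≤ n * x := by rw [SCN_eq] at h; exact_mod_cast h
  have hn' : (0:ℝ) < n := by exact_mod_cast hn
  rw [Int.cast_natCast, div_le_div_iff₀ hn' SC_pos]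
  nlinarith [h']

/-- Reading `u·u ≤ x·SCN` as `(u/SC)² ≤ x/SC`. [folklore] -/
theorem sq_div_le_of_nat {u x : ℕ} (h : u * u ≤ x * SCN) : (((u : ℤ) : ℝ) / SC) ^ 2 ≤ ((x : ℤ) : ℝ) / SC := by
  have h' : (u : ℝ) * u ≤ x * SC := by rw [SCN_eq] at h; exact_mod_cast h
  have hS := SC_pos
  rw [Int.cast_natCast, Int.cast_natCast, div_pow, sq, sq, div_le_div_iff₀ (mul_pos hS hS) hS]
  nlinarith [h']

/-- Reading `x·SCN ≤ u·u` as `x/SC ≤ (u/SC)²`. [folklore] -/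
theorem div_le_sq_of_nat {u x : ℕ} (h : x * SCN ≤ u * u) : ((x : ℤ) : ℝ) / SC ≤ (((u : ℤ) : ℝ) / SC) ^ 2 := by
  have h' : (x : ℝ) * SC ≤ u * u := by rw [SCN_eq] at h; exact_mod_cast h
  have hS := SC_pos
  rw [Int.cast_natCast, Int.cast_natCast, div_pow, sq, sq, div_le_div_iff₀ hS (mul_pos hS hS)]
  nlinarith [h']

/-- Window mode is sound. [folklore] -/
theorem Row.okWin_sound {E : ℕ} {r : Row} (h : r.okWin E = true) :
    ((sgnZ r.sV r.aV : ℤ) : ℝ) / SC ≤ effPot w₄₅ ω₄ (3 / 400) (Real.sqrt (((r.t : ℤ) : ℝ) / SC)) ∧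
    deriv (effPot w₄₅ ω₄ (3 / 400)) (Real.sqrt (((r.t : ℤ) : ℝ) / SC)) / (2 * Real.sqrt (((r.t : ℤ) : ℝ) / SC)) ∈
      Icc (((sgnZ r.sD r.aD - (E : ℤ) : ℤ) : ℝ) / SC) (((sgnZ r.sD r.aD + (E : ℤ) : ℤ) : ℝ) / SC) ∧
    0 ≤ ((r.M : ℤ) : ℝ) / SC ∧
    MonotoneOn (fun t => deriv (effPot w₄₅ ω₄ (3 / 400)) (Real.sqrt t) / (2 * Real.sqrt t) + ((r.M : ℤ) : ℝ) / SC * t)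
      (Icc (((r.A : ℤ) : ℝ) / SC) (((r.B : ℤ) : ℝ) / SC)) ∧
    0 < r.A ∧ r.A ≤ r.t ∧ r.t ≤ r.B := by
  unfold Row.okWin at h
  simp only [Bool.and_eq_true, Nat.ble_eq, Nat.beq_eq, Nat.blt_eq, decide_eq_true_eq, Nat.mul_eq, Nat.add_eq, Nat.sub_eq] at h
  obtain ⟨⟨⟨⟨⟨⟨⟨⟨⟨⟨hss, h9A⟩, hAt⟩, htB⟩, ht81⟩, hU⟩, hsA⟩, hV⟩, hDlo⟩, hDhi⟩, hcurv⟩ := h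
  have hS := SC_pos
  -- the grid point and its exact root
  have hUle : U42 ≤ r.s := le_of_lt hU
  have hs_pos : 0 < r.s := lt_of_le_of_lt (Nat.zero_le _) hU
  have hsZ : (0 : ℤ) < (r.s : ℤ) := by exact_mod_cast hs_pos
  have ht9 : (9 : ℝ) ≤ ((r.t : ℤ) : ℝ) / SC := by
    have h' : 9 * SCN ≤ 1 * r.t := by omega
    have := le_div_of_nat (m := 9) (n := 1) (by norm_num) h'
    norm_num at this
    exact this
  have ht81 : ((r.t : ℤ) : ℝ) / SC ≤ 81 / 4 := div_le_of_nat (by norm_num) ht81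
  have htpos : (0 : ℝ) < ((r.t : ℤ) : ℝ) / SC := by linarith
  have htZ : 0 < (FI.ofScaled (r.t : ℤ)).lo := by
    have h' : (0:ℝ) < ((r.t : ℤ) : ℝ) := by have := mul_pos htpos hS; rwa [div_mul_cancel₀ _ hS.ne'] at this
    have h'' : (0 : ℤ) < (r.t : ℤ) := by exact_mod_cast h'
    exact h''
  have hroot : (((r.s : ℤ) : ℝ) / SC) ^ 2 = ((r.t : ℤ) : ℝ) / SC := by
    have e : (r.s : ℝ) * r.s = r.t * SC := by rw [SCN_eq] at hss; exact_mod_cast hss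
    simp only [Int.cast_natCast]
    rw [div_pow, div_eq_div_iff (pow_pos hS 2).ne' hS.ne']
    calc (r.s : ℝ) ^ 2 * SC = (r.s * r.s) * SC := by ring
      _ = r.t * SC * SC := by rw [e]
      _ = r.t * (SC : ℝ) ^ 2 := by ring
  have hs0 : (0 : ℝ) < ((r.s : ℤ) : ℝ) / SC := div_pos (by exact_mod_cast hs_pos) hS
  have hq := FI.mem_ofScaled (r.t : ℤ)
  -- (1) value
  have h1 : ((sgnZ r.sV r.aV : ℤ) : ℝ) / SC ≤ effPot w₄₅ ω₄ (3 / 400) (Real.sqrt (((r.t : ℤ) : ℝ) / SC)) := by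
    have hmain := phi45_window_ge ht9 ht81 hs0.le hroot.symm.le
    exact le_trans (le_trans (div_le_div_of_nonneg_right (by exact_mod_cast hV) hS.le) (FI.lo_div_le (mem_eWinVal hq htZ))) hmain
  -- (2) derivative
  have h2 : deriv (effPot w₄₅ ω₄ (3 / 400)) (Real.sqrt (((r.t : ℤ) : ℝ) / SC)) / (2 * Real.sqrt (((r.t : ℤ) : ℝ) / SC)) ∈
      Icc (((sgnZ r.sD r.aD - (E : ℤ) : ℤ) : ℝ) / SC) (((sgnZ r.sD r.aD + (E : ℤ) : ℤ) : ℝ) / SC) := by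
    have hlow := dphi45_window_ge ht9 ht81 hs0 hroot.le hs0.le hroot.symm.le
    have hupp := dphi45_window_le ht9 ht81 hs0 hroot.le hs0.le hroot.symm.le
    have mL := FI.lo_div_le (mem_eWinDer hsZ hsZ)
    have mU := FI.le_hi_div (mem_eWinDer hsZ hsZ)
    exact ⟨le_trans (div_le_div_of_nonneg_right (by exact_mod_cast hDlo) hS.le) (mL.trans hlow),
      le_trans (hupp.trans mU) (div_le_div_of_nonneg_right (by exact_mod_cast hDhi) hS.le)⟩
  -- (3) curvature on [A, B]
  have hA9 : (9 : ℝ) ≤ ((r.A : ℤ) : ℝ) / SC := by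
    have h' : 9 * SCN ≤ 1 * r.A := by omega
    have := le_div_of_nat (m := 9) (n := 1) (by norm_num) h'
    norm_num at this
    exact this
  have hM0 : 0 ≤ ((r.M : ℤ) : ℝ) / SC := div_nonneg (by exact_mod_cast Nat.zero_le _) hS.le
  have hs1pos : 0 < r.s - U42 := Nat.sub_pos_of_lt hU
  have hs1Z : (0 : ℤ) < ((r.s - U42 : ℕ) : ℤ) := by exact_mod_cast hs1pos
  have hs1R : (0 : ℝ) < (((r.s - U42 : ℕ) : ℤ) : ℝ) / SC := div_pos (by exact_mod_cast hs1pos) hS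
  have hs1sq : ((((r.s - U42 : ℕ) : ℤ) : ℝ) / SC) ^ 2 ≤ ((r.A : ℤ) : ℝ) / SC := sq_div_le_of_nat hsA
  have hAB : ((r.A : ℤ) : ℝ) / SC ≤ ((r.t : ℤ) : ℝ) / SC := div_le_div_of_nonneg_right (by exact_mod_cast hAt) hS.le
  have h3 : MonotoneOn (fun t => deriv (effPot w₄₅ ω₄ (3 / 400)) (Real.sqrt t) / (2 * Real.sqrt t) + ((r.M : ℤ) : ℝ) / SC * t)
      (Icc (((r.A : ℤ) : ℝ) / SC) (((r.B : ℤ) : ℝ) / SC)) := by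
    revert hcurv
    cases hcase : Nat.ble (4 * r.B) (81 * SCN) <;> intro hcurv
    · -- B beyond 81/4: window on [A, 81/4] glued with far on [81/4, B]
      simp only [decide_eq_true_eq] at hcurv
      have hB81 : (81 : ℝ) / 4 ≤ ((r.B : ℤ) : ℝ) / SC := by
        have h' : ¬ (4 * r.B ≤ 81 * SCN) := fun hle => by
          have := Nat.ble_eq_true_of_le hle
          rw [this] at hcase
          exact Bool.noConfusion hcase
        exact le_div_of_nat (by norm_num) (le_of_lt (not_le.1 h'))
      have h92 : (0 : ℤ) < 9 * (SC : ℤ) / 2 := by rw [← SCN_eq]; decide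
      have hmem := mem_eWin hs1Z h92
      have e92 : (((9 * (SC : ℤ) / 2 : ℤ)) : ℝ) / SC = 9 / 2 := by
        rw [← SCN_eq]; push_cast [SCN]; norm_num [SCN]
      rw [e92] at hmem
      have hle := (FI.le_hi_div hmem).trans (div_le_div_of_nonneg_right (show ((eWin _ _).hi : ℝ) ≤ (r.M : ℤ) by exact_mod_cast hcurv) hS.le)
      have hw := monotoneOn_dphi45_window hA9 le_rfl hs1R hs1sq (show (81:ℝ)/4 ≤ (9/2) ^ 2 by norm_num) (by norm_num) hle
      exact monotoneOn_Icc_of_pieces (hAB.trans ht81) hB81 hw (monotoneOn_dphi45_far le_rfl hM0)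
    · -- B ≤ 81/4: window on [A, B] with roots s ∓ 2^42
      simp only [Bool.and_eq_true, Nat.ble_eq, decide_eq_true_eq] at hcurv
      obtain ⟨hBs, hM⟩ := hcurv
      have hB81 : ((r.B : ℤ) : ℝ) / SC ≤ 81 / 4 := div_le_of_nat (by norm_num) (by simpa [Nat.ble_eq] using hcase)
      have hs2Z : (0 : ℤ) < ((r.s + U42 : ℕ) : ℤ) := by exact_mod_cast Nat.add_pos_left hs_pos U42
      have hs2R : (0 : ℝ) ≤ (((r.s + U42 : ℕ) : ℤ) : ℝ) / SC := div_nonneg (by exact_mod_cast Nat.zero_le _) hS.le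
      have hs2sq : ((r.B : ℤ) : ℝ) / SC ≤ ((((r.s + U42 : ℕ) : ℤ) : ℝ) / SC) ^ 2 := div_le_sq_of_nat hBs
      have hmem := mem_eWin hs1Z hs2Z
      have hle := (FI.le_hi_div hmem).trans (div_le_div_of_nonneg_right (show ((eWin _ _).hi : ℝ) ≤ (r.M : ℤ) by exact_mod_cast hM) hS.le)
      exact monotoneOn_dphi45_window hA9 hB81 hs1R hs1sq hs2sq hs2R hle
  have hApos : 0 < r.A := by
    have : (0:ℝ) < ((r.A : ℤ) : ℝ) / SC := by linarith
    have h' : (0:ℝ) < ((r.A : ℤ) : ℝ) := by have := mul_pos this hS; rwa [div_mul_cancel₀ _ hS.ne'] at this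
    exact_mod_cast h'
  exact ⟨h1, h2, hM0, h3, hApos, hAt, htB⟩

/-- ★ **ROW SEMANTICS.**  A certified row delivers, in real terms (`φ = W₄₅ ∘ √`, data divided by `SC`): the value bound at the grid point, the
derivative enclosure of half-width `E` around the stored midpoint, the curvature constant on `[A, B]` (`φ′ + (M/SC)·id` monotone), `0 < A ≤ t ≤ B`. [folklore] -/
theorem Row.ok_sound {E : ℕ} {r : Row} (h : r.ok E = true) :
    ((sgnZ r.sV r.aV : ℤ) : ℝ) / SC ≤ effPot w₄₅ ω₄ (3 / 400) (Real.sqrt (((r.t : ℤ) : ℝ) / SC)) ∧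
    deriv (effPot w₄₅ ω₄ (3 / 400)) (Real.sqrt (((r.t : ℤ) : ℝ) / SC)) / (2 * Real.sqrt (((r.t : ℤ) : ℝ) / SC)) ∈
      Icc (((sgnZ r.sD r.aD - (E : ℤ) : ℤ) : ℝ) / SC) (((sgnZ r.sD r.aD + (E : ℤ) : ℤ) : ℝ) / SC) ∧
    0 ≤ ((r.M : ℤ) : ℝ) / SC ∧
    MonotoneOn (fun t => deriv (effPot w₄₅ ω₄ (3 / 400)) (Real.sqrt t) / (2 * Real.sqrt t) + ((r.M : ℤ) : ℝ) / SC * t)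
      (Icc (((r.A : ℤ) : ℝ) / SC) (((r.B : ℤ) : ℝ) / SC)) ∧
    0 < r.A ∧ r.A ≤ r.t ∧ r.t ≤ r.B := by
  unfold Row.ok at h
  rcases Bool.or_eq_true_iff.1 h with hg | hw
  · exact Row.okGen_sound hg
  · exact Row.okWin_sound hw

/-- Any row returned by `findLE` from a certified table (and a certified or empty `best`) is certified. [formal bookkeeping] -/
theorem QT.findLE_ok {E : ℕ} (q : ℕ) :
    ∀ (tab : QT) (best : Option Row), tab.allOK E = true → (∀ r, best = some r → r.ok E = true) →
      ∀ r, tab.findLE q best = some r → r.ok E = true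
  | .nil, best, _, hbest, r, hr => hbest r hr
  | .node l row rt, best, htab, hbest, r, hr => by
    simp only [QT.allOK, Bool.and_eq_true] at htab
    obtain ⟨⟨hl, hrow⟩, hrt⟩ := htab
    unfold QT.findLE at hr
    split at hr
    · exact QT.findLE_ok q l best hl hbest r hr
    · exact QT.findLE_ok q rt (some row) hrt (fun r' hr' => by cases hr'; exact hrow) r hr

/-- The row found for a label from a certified table, searched from `none`, is certified. [formal bookkeeping] -/
theorem QT.findLE_none_ok {E : ℕ} {q : ℕ} {tab : QT} (htab : tab.allOK E = true) {r : Row} (hr : tab.findLE q none = some r) :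
    r.ok E = true :=
  QT.findLE_ok q tab none htab (fun _ h => by cases h) r hr

end Summit.AtomisticToContinuum.Crystallization.Theorems.FrustratedLawDichotomyStrainedPatchHomLeafTableCheck
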